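import Summits.RiemannHypothesis.RiemannHypothesis.Theorems.Splittings.RobinFiniteCakePeel

/-!
# RobinFiniteCakeNum — gen 19 «LAYER CAKE AT PT», part 3/10 (C): numeral / absorption helpers — `rpow_le_of_pow_le`, the tangent-line bound `log t ≤ t^{1/w}·w/e` (`logRpow_le_tangentE`), the three-term row absorption `count_le_rpow_of_row3E` (`c₁ t^p log^q t + c₂ log²t + c₃ log t ≤ A·t^a`), and the mass enclosure `massExpr_le`. RH-free, 0 `def`.

Cell rh-split, seat rh-split-robin-finite g19 (card `cards/SPLIT-robin-finite.md` §26); carved VERBATIM from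
`HOME/rh-split-robin-finite/g19/SketchG19.lean` (sha16 c333eb23d46ea866) by `mk_carve.py`.  Nothing here bears on the truth of RH.

HONEST LABEL: SPLITTING SEARCH over kernel-typed RH-EQUIVALENCES; a splitting A ∧ B ⟹ RH is CONDITIONAL
bookkeeping unless A and B are both proved; nothing here bears on the truth of RH.
-/

set_option linter.dupNamespace false

noncomputable section

open Real Filter Finset
open scoped Chebyshev ComplexConjugate

namespace Summit.RiemannHypothesis.RiemannHypothesis.Theorems.Splittings.RobinFiniteC1

open Literature.NumberTheory.LFunctions Literature.NumberTheory.DiophantineGeometry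
open Literature.NumberTheory.LFunctions.SchoenfeldBound
open Literature.NumberTheory.LFunctions.NicolasJExplicit
open RobinAnalyticSharp
open Literature.NumberTheory.LFunctions.VdC.Num (rpow_le_of_pow_le le_rpow_of_pow_le)
open Summit.RiemannHypothesis.RiemannHypothesis.Theorems.Splittings.RobinFiniteE3
open Summit.RiemannHypothesis.RiemannHypothesis.Theorems.Splittings.RobinFiniteTail
  (zeroTailBound_tailH tailH_PT_le tailH_nonneg)
open Summit.RiemannHypothesis.RiemannHypothesis.Theorems.Splittings.RobinFiniteE1c (summable_tailTerm)

section CakeNum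

/-! ### C5 · numeral tools: rational `rpow` enclosures and the `e`-form of the tangent absorption -/

/-- Side condition via `e > 2.7182818283` (Mathlib `Real.exp_one_gt_d9`): `q ≤ c·(2.7182818283·w)` gives `q ≤ c·(e·w)` (`c, w ≥ 0`). -/
theorem le_mul_exp_one_mul {q c w : ℝ} (hc : 0 ≤ c) (hw : 0 ≤ w) (h : q ≤ c * (2.7182818283 * w)) :
    q ≤ c * (Real.exp 1 * w) := by
  have he := Real.exp_one_gt_d9
  have : c * (2.7182818283 * w) ≤ c * (Real.exp 1 * w) :=
    mul_le_mul_of_nonneg_left (mul_le_mul_of_nonneg_right he.le hw) hc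
  linarith

/-- **Tangent-line absorption**: for `t > 1`, `q ≥ 0`, `u₁ > 0`: `(log t)^q ≤ (u₁^q · exp(−q)) · t^(q/u₁)`. -/
theorem logRpow_le_tangent {t q u₁ : ℝ} (ht : 1 < t) (hq : 0 ≤ q) (hu₁ : 0 < u₁) :
    Real.log t ^ q ≤ u₁ ^ q * Real.exp (-q) * t ^ (q / u₁) := by
  have ht0 : 0 < t := by linarith
  set u := Real.log t with hu
  have hu0 : 0 < u := Real.log_pos ht
  have hlog : Real.log u ≤ Real.log u₁ + (u / u₁ - 1) := by
    have h := Real.log_le_sub_one_of_pos (show 0 < u / u₁ by positivity)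
    rw [Real.log_div hu0.ne' hu₁.ne'] at h
    linarith
  have e1 : u ^ q = Real.exp (q * Real.log u) := by
    rw [Real.rpow_def_of_pos hu0, mul_comm]
  have e2 : u₁ ^ q = Real.exp (q * Real.log u₁) := by
    rw [Real.rpow_def_of_pos hu₁, mul_comm]
  have e3 : t ^ (q / u₁) = Real.exp (q * (u / u₁)) := by
    rw [Real.rpow_def_of_pos ht0, ← hu]; ring_nf
  rw [e1, e2, e3, ← Real.exp_add, ← Real.exp_add]
  exact Real.exp_le_exp.2 (by nlinarith [mul_le_mul_of_nonneg_left hlog hq])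

/-- **`e`-form**: for `t > 1`, `q ≥ 0`, `w > 0`: `(log t)^q ≤ w^q · t^(q/(e·w))` (tangent point `u₁ = e·w`). -/
theorem logRpow_le_tangentE {t q w : ℝ} (ht : 1 < t) (hq : 0 ≤ q) (hw : 0 < w) :
    Real.log t ^ q ≤ w ^ q * t ^ (q / (Real.exp 1 * w)) := by
  have he : 0 < Real.exp 1 := Real.exp_pos 1
  have h := logRpow_le_tangent ht hq (mul_pos he hw)
  have e1 : (Real.exp 1 * w) ^ q * Real.exp (-q) = w ^ q := by
    rw [Real.mul_rpow he.le hw.le, Real.exp_one_rpow, mul_assoc, mul_comm (w ^ q), ← mul_assoc, ← Real.exp_add,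
      add_neg_cancel, Real.exp_zero, one_mul]
  rw [e1] at h
  exact h

/-- **Row absorption, `e`-form** (three-term printed rows): from
`N(σ, t) ≤ c₁·t^p·(log t)^q + c₂·(log t)² + c₃·log t` (`t ≥ 3·10¹²`; constants `≥ 0`) and `w₁, w₂, w₃ > 0` with
`q ≤ (a − p)·(e·w₁)`, `2 ≤ a·(e·w₂)`, `1 ≤ a·(e·w₃)`, `p ≤ a`:  `N(σ, t) ≤ (c₁·w₁^q + c₂·w₂² + c₃·w₃)·t^a` for `t ≥ 3·10¹²`. -/
theorem count_le_rpow_of_row3E {σ c₁ c₂ c₃ p q a w₁ w₂ w₃ : ℝ}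
    (hc₁ : 0 ≤ c₁) (hc₂ : 0 ≤ c₂) (hc₃ : 0 ≤ c₃) (hq : 0 ≤ q) (hw₁ : 0 < w₁) (hw₂ : 0 < w₂) (hw₃ : 0 < w₃) (hpa : p ≤ a)
    (ha₁ : q ≤ (a - p) * (Real.exp 1 * w₁)) (ha₂ : 2 ≤ a * (Real.exp 1 * w₂)) (ha₃ : 1 ≤ a * (Real.exp 1 * w₃))
    (hrow : ∀ t : ℝ, 3 * (10 : ℝ) ^ 12 ≤ t →
      (zetaZeroCountRe σ t : ℝ) ≤ c₁ * t ^ p * Real.log t ^ q + c₂ * Real.log t ^ 2 + c₃ * Real.log t) :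
    ∀ t : ℝ, 3 * (10 : ℝ) ^ 12 ≤ t →
      (zetaZeroCountRe σ t : ℝ) ≤ (c₁ * w₁ ^ q + c₂ * w₂ ^ 2 + c₃ * w₃) * t ^ a := by
  intro t ht
  have ht1 : 1 < t := lt_of_lt_of_le (by norm_num) ht
  have ht0 : 0 < t := by linarith
  have he : 0 < Real.exp 1 := Real.exp_pos 1
  have hta : 0 ≤ t ^ a := Real.rpow_nonneg ht0.le a
  -- exponent comparisons
  have hx₁ : p + q / (Real.exp 1 * w₁) ≤ a := by
    rcases eq_or_lt_of_le hpa with hpa' | hpa'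
    · -- p = a forces q ≤ 0, hence q = 0
      have hq0 : q ≤ 0 := by rw [hpa', sub_self, zero_mul] at ha₁; exact ha₁
      have : q / (Real.exp 1 * w₁) ≤ 0 := div_nonpos_of_nonpos_of_nonneg (by linarith) (by positivity)
      linarith
    · have hpos : 0 < a - p := sub_pos.2 hpa'
      have : q / (Real.exp 1 * w₁) ≤ a - p := by
        rw [div_le_iff₀ (by positivity)]; linarith
      linarith
  have hx₂ : 2 / (Real.exp 1 * w₂) ≤ a := by
    have ha0 : 0 < a := by
      by_contra h; rw [not_lt] at h
      have : a * (Real.exp 1 * w₂) ≤ 0 := mul_nonpos_of_nonpos_of_nonneg h (by positivity)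
      linarith
    rw [div_le_iff₀ (by positivity)]; linarith
  have hx₃ : 1 / (Real.exp 1 * w₃) ≤ a := by
    have ha0 : 0 < a := by
      by_contra h; rw [not_lt] at h
      have : a * (Real.exp 1 * w₃) ≤ 0 := mul_nonpos_of_nonpos_of_nonneg h (by positivity)
      linarith
    rw [div_le_iff₀ (by positivity)]; linarith
  -- term 1
  have h1 : t ^ p * Real.log t ^ q ≤ w₁ ^ q * t ^ a := by
    have hlog := logRpow_le_tangentE ht1 hq hw₁
    calc t ^ p * Real.log t ^ q ≤ t ^ p * (w₁ ^ q * t ^ (q / (Real.exp 1 * w₁))) :=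
          mul_le_mul_of_nonneg_left hlog (Real.rpow_nonneg ht0.le p)
      _ = w₁ ^ q * t ^ (p + q / (Real.exp 1 * w₁)) := by rw [Real.rpow_add ht0]; ring
      _ ≤ w₁ ^ q * t ^ a :=
          mul_le_mul_of_nonneg_left (Real.rpow_le_rpow_of_exponent_le ht1.le hx₁) (Real.rpow_nonneg hw₁.le q)
  -- term 2
  have h2 : Real.log t ^ 2 ≤ w₂ ^ 2 * t ^ a := by
    have hlog := logRpow_le_tangentE ht1 (by norm_num : (0 : ℝ) ≤ 2) hw₂
    rw [Real.rpow_two, Real.rpow_two] at hlog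
    calc Real.log t ^ 2 ≤ w₂ ^ 2 * t ^ (2 / (Real.exp 1 * w₂)) := hlog
      _ ≤ w₂ ^ 2 * t ^ a := mul_le_mul_of_nonneg_left (Real.rpow_le_rpow_of_exponent_le ht1.le hx₂) (sq_nonneg _)
  -- term 3
  have h3 : Real.log t ≤ w₃ * t ^ a := by
    have hlog := logRpow_le_tangentE ht1 (by norm_num : (0 : ℝ) ≤ 1) hw₃
    rw [Real.rpow_one, Real.rpow_one] at hlog
    calc Real.log t ≤ w₃ * t ^ (1 / (Real.exp 1 * w₃)) := hlog
      _ ≤ w₃ * t ^ a := mul_le_mul_of_nonneg_left (Real.rpow_le_rpow_of_exponent_le ht1.le hx₃) hw₃.le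
  calc (zetaZeroCountRe σ t : ℝ) ≤ c₁ * t ^ p * Real.log t ^ q + c₂ * Real.log t ^ 2 + c₃ * Real.log t := hrow t ht
    _ = c₁ * (t ^ p * Real.log t ^ q) + c₂ * Real.log t ^ 2 + c₃ * Real.log t := by ring
    _ ≤ c₁ * (w₁ ^ q * t ^ a) + c₂ * (w₂ ^ 2 * t ^ a) + c₃ * (w₃ * t ^ a) :=
        add_le_add (add_le_add (mul_le_mul_of_nonneg_left h1 hc₁) (mul_le_mul_of_nonneg_left h2 hc₂))
          (mul_le_mul_of_nonneg_left h3 hc₃)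
    _ = _ := by ring

/-- The symbolic layer mass `4·A·4^a·T^(a−2)/(1 − 4^(a−2))` is nonnegative (`0 ≤ A`, `a < 2`, `0 < T`). -/
theorem massExpr_nonneg {A a T : ℝ} (hA : 0 ≤ A) (ha : a < 2) (hT : 0 < T) :
    0 ≤ 2 * (2 * (A * (4 : ℝ) ^ a * T ^ (a - 2) / (1 - (4 : ℝ) ^ (a - 2)))) := by
  have hr1 : (4 : ℝ) ^ (a - 2) < 1 := Real.rpow_lt_one_of_one_lt_of_neg (by norm_num) (by linarith)
  have : 0 ≤ A * (4 : ℝ) ^ a * T ^ (a - 2) / (1 - (4 : ℝ) ^ (a - 2)) := div_nonneg (by positivity) (by linarith)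
  positivity

/-- **Mass enclosure**: with `4^a ≤ c₄ < 16` and `T^a ≤ c_T` (`0 < T`, `0 ≤ A`):
`2·(2·(A·4^a·T^(a−2)/(1 − 4^(a−2)))) ≤ M̄` as soon as `4·A·c₄·c_T/T²/(1 − c₄/16) ≤ M̄`. -/
theorem massExpr_le {A a T c₄ cT Mbar : ℝ} (hT : 0 < T) (hA : 0 ≤ A) (h4 : (4 : ℝ) ^ a ≤ c₄) (hc₄ : c₄ < 16)
    (hTa : T ^ a ≤ cT) (hM : 4 * A * c₄ * cT / T ^ 2 / (1 - c₄ / 16) ≤ Mbar) :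
    2 * (2 * (A * (4 : ℝ) ^ a * T ^ (a - 2) / (1 - (4 : ℝ) ^ (a - 2)))) ≤ Mbar := by
  have h40 : 0 < (4 : ℝ) ^ a := Real.rpow_pos_of_pos (by norm_num) a
  have e4 : (4 : ℝ) ^ (a - 2) = (4 : ℝ) ^ a / 16 := by
    rw [Real.rpow_sub (by norm_num : (0 : ℝ) < 4), Real.rpow_two]; norm_num
  have eT : T ^ (a - 2) = T ^ a / T ^ 2 := by rw [Real.rpow_sub hT, Real.rpow_two]
  rw [e4, eT]
  have hden : 0 < 1 - c₄ / 16 := by linarith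
  have hden' : 1 - c₄ / 16 ≤ 1 - (4 : ℝ) ^ a / 16 := by linarith
  have hTa0 : 0 ≤ T ^ a := Real.rpow_nonneg hT.le a
  have hnum : A * (4 : ℝ) ^ a * (T ^ a / T ^ 2) ≤ A * c₄ * cT / T ^ 2 := by
    have : (4 : ℝ) ^ a * T ^ a ≤ c₄ * cT := mul_le_mul h4 hTa hTa0 (by linarith)
    have hT2 : 0 < T ^ 2 := by positivity
    calc A * (4 : ℝ) ^ a * (T ^ a / T ^ 2) = A * ((4 : ℝ) ^ a * T ^ a) / T ^ 2 := by ring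
      _ ≤ A * (c₄ * cT) / T ^ 2 := by gcongr
      _ = A * c₄ * cT / T ^ 2 := by ring
  have hnum0 : 0 ≤ A * (4 : ℝ) ^ a * (T ^ a / T ^ 2) := by positivity
  calc 2 * (2 * (A * (4 : ℝ) ^ a * (T ^ a / T ^ 2) / (1 - (4 : ℝ) ^ a / 16)))
      = 4 * (A * (4 : ℝ) ^ a * (T ^ a / T ^ 2) / (1 - (4 : ℝ) ^ a / 16)) := by ring
    _ ≤ 4 * (A * c₄ * cT / T ^ 2 / (1 - c₄ / 16)) := by
        refine mul_le_mul_of_nonneg_left ?_ (by norm_num)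
        exact div_le_div₀ (le_trans hnum0 hnum) hnum hden hden'
    _ = 4 * A * c₄ * cT / T ^ 2 / (1 - c₄ / 16) := by ring
    _ ≤ Mbar := hM

end CakeNum

end Summit.RiemannHypothesis.RiemannHypothesis.Theorems.Splittings.RobinFiniteC1

end
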